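import Summits.BirchSwinnertonDyer.BirchSwinnertonDyer.Theses.KatoTransfer
import Literature.NumberTheory.EllipticCurves.BSDSelmer

/-!
# Crux `AnalyticRankLeSelmerCorank` (stmt-BirchSwinnertonDyer-18412) — birth skeleton `Lines/birth.lean`

Route `KatoTransfer` (route-BirchSwinnertonDyer-KatoTransfer), crux #3 (rank 3, card item X2): for
`W/ℚ` globally minimal elliptic and EVERY prime `p ≥ 5` of good ordinary reduction,
`ord_{s=1} L(E,s) ≤ corank_{ℤ_p} Sel_{p^∞}(E/ℚ)` — the `≤` half of the rank-`r` `p`-converse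
(Burungale–Tian, Ann. of Math. 203 (2026), eq. (1.1): `corank Sel_{p^∞} = r ⟹ ord_{s=1} L = r`),
a consequence of BSD-rank (`r_an = rank ≤ corank Sel_{p^∞}` by the Kummer sequence; the refuter's
`CruxAttackProbes.lean` next to this file proves `BirchSwinnertonDyer → C` hypothesis-free). The crux
is FIXED (decl `Summit.BirchSwinnertonDyer.BirchSwinnertonDyer.Theses.KatoTransfer.AnalyticRankLeSelmerCorank`);
this file is the tree copy of the birth line whose three stubs the route's planner registered on the
item at birth (`ledger skeleton check`, 2026-08-17T16:06Z: `stub_pConverseSector`,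
`stub_pParityAdmissible`, `stub_weakBoundCorankGeTwo` — names and signatures below are VERBATIM the
registered ones), i.e. the split foreseen in the route header (TWO-LAYER PLAN:
`AnalyticRankLeSelmerCorank ⇐ PConverseSector (corank ≤ 1) + PParityAdmissible (s_p ≡ r_an mod 2) +
WeakBoundCorankGeTwo (corank ≥ 2 ⇒ r_an ≤ s_p + 1)`). It proves nothing else.

## Line `birth` — `p`-converse sector + `p`-parity + weak bound (3 stubs + composition)

Write `s_p = corank_{ℤ_p} Sel_{p^∞}(E/ℚ)` and `r_an = ord_{s=1} L(E,s)`; `(E,p)` ranges over the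
crux's sector (global minimal model, `p ≥ 5` prime, good ordinary reduction at `p`). The crux is an
UPPER bound on `r_an`, i.e. a NON-VANISHING statement `L^{(k)}(E,1) ≠ 0` for some `k ≤ s_p`, to be
driven by Selmer smallness. In print this exists exactly for `s_p ≤ 1`, and the `p`-parity theorem
converts any bound that is off by one into the sharp one:

* `stub_pConverseSector` — `s_p ≤ 1 ⟹ r_an ≤ s_p`: the two `p`-CONVERSE theorems.
  `s_p = 0 ⟹ L(E,1) ≠ 0` (rank zero): cyclotomic main conjecture + control — `Sel_{p^∞}` finite ⟹
  `f_E(0) ≠ 0` (Greenberg LNM 1716 Thm. 4.1) ⟹ `L_p(E,0) ≠ 0` ⟹ `L(E,1) ≠ 0` (Kato + Skinner–Urban /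
  Burungale–Castella–Skinner 2025); in the tree modulo named facts when `E[p]` is irreducible:
  `analyticRank_eq_zero_of_selmerCorank_eq_zero_of_mazurMainConjecture` (facts `exists_isNewformOf`,
  `burungale_castella_skinner_charIdeal_eq_padicLFunction`); CM at every `p`: Burungale–Tian 2026
  Thm. 1.1. `s_p = 1 ⟹ r_an ≤ 1` (rank one, non-vanishing half): Skinner 2020 Thm. A′, W. Zhang 2014,
  Burungale–Skinner–Tian–Wan 2024 Thm. 1.10 (tree fact
  `burungaleSkinnerTianWan_analyticRank_eq_one_of_selmerCorank_eq_one`, under `(sur_ℚ)` + `(ram)`),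
  Kim 2022 Cor. 1.4, Burungale–Castella–Skinner 2025 (`E[p]` irreducible, `p > 3` good ordinary, no
  conductor hypothesis), Burungale–Tian 2019 (CM), Castella–Grossi–Lee–Skinner Thm. E (Eisenstein `p`).
  NOT fully in print as typed (refuter note r1): at Eisenstein `p` (rational `p`-isogeny, `p ∈ {5, 7,
  11, 13, 17, 19, 37, 43, 67, 163}`) outside the character condition of CGLS / the Eisenstein main
  conjecture (Castella–Grossi–Skinner 2025) both cases are open, and no image hypothesis may be added
  (the route's thesis: no item carries an image-of-Galois hypothesis).
* `stub_pParityAdmissible` — `s_p ≡ r_an (mod 2)` on the sector: the `p`-parity THEOREM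
  (Dokchitser–Dokchitser 2010 Thm. 1.4, all `E/ℚ`, all `p`; at good ordinary `p` already Nekovář),
  verbatim the body of the tree's named fact `selmerCorank_mod_two_eq W p` (derivable in tree from the
  facts `Nekovar2013_theoremA` + `hasEntireLFunction_rat`: `selmerCorank_mod_two_eq_of_nekovar`).
  Known, unformalised; it is what makes the `+ 1` of the next stub free.
* `stub_weakBoundCorankGeTwo` — `s_p ≥ 2 ⟹ r_an ≤ s_p + 1`: the LOAD-BEARING, OPEN stub. Modulo
  `p`-parity it is exactly the crux on the sector `s_p ≥ 2` (refuter note r1; the mirror statement for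
  the opposite inequality is `gap_two_of_parity` in `Cruxes/SelmerRankUB/Disproof.lean`); its slice
  `r_an ≤ 3` is vacuous arithmetic (`r_an ≤ 3 ≤ s_p + 1`), so its content starts at the FIRST OPEN
  CELL `r_an = 4, s_p = 2` (in general `r_an ≥ 4`, `s_p = r_an - 2`: the inequality half of the
  rank-`s_p` `p`-converse). No mechanism producing `L^{(k)}(E,1) ≠ 0` for some `k ≤ s_p + 1` from
  `s_p ≥ 2` is in print (no Gross–Zagier formula for `L^{(k)}(E,1)`, `k ≥ 2`; generalised Kato classes,
  Castella–Hsieh 2022, run from `L`-vanishing to Selmer classes, not back). Why plausibly true: it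
  follows from BSD-rank alone (`r_an = rank ≤ s_p`), so a counterexample disproves BSD (the refuter's
  `S → C`).
* `AnalyticRankLeSelmerCorank_of` — COMPOSITION (real proof; the crux BY NAME from the three stubs):
  case `s_p ≤ 1`: stub 1; case `s_p ≥ 2`: stub 3 gives `r_an ≤ s_p + 1` and stub 2
  (`r_an ≡ s_p mod 2`) forbids `r_an = s_p + 1`; `omega`. The argument is carried by the `sorry`-free
  hypothesis form `analyticRank_le_selmerCorank_of_sectors` (the three stub signatures as hypotheses,
  the crux's statement unfolded as conclusion; axioms `propext`, `Classical.choice`, `Quot.sound`),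
  which `AnalyticRankLeSelmerCorank_of` applies to the three stubs.

Honesty notes. (1) Stubs 1–2 are theorems in print up to the Eisenstein residue of stub 1
(formalising either unconditionally is XL: each sits on modularity and a main conjecture, held in the
tree as named facts); stub 3 carries the whole open content of the crux (corank ≥ 2), weakened by
exactly the parity bit — the route header records that no finer cut of that sector is known ("NOT
DECOMPOSED YET … decomposing them now would be shredding") and the refuter's crux-attack r1 confirms
"the split isolates nothing on the open sector". (2) Equivalent forms considered and NOT registered
(seat notes, `bc/birth_v1_4stubs.lean`): cutting stub 1 into its corank-`0` / corank-`1` theorems (4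
stubs; same content, finer bookkeeping — rejected only to keep the registered stub set unchanged), and
the uniform two-stub form "parity ∧ `r_an ≤ s_p + 1` at every `s_p`" (modulo parity the crux IS the
uniform weak bound; the sector form is kept because for `s_p ≤ 1` the SHARP bound is what is in print).
The `p`-adic cut `r_an ≤ ord_T L_p(E,T)` ∧ main-conjecture lower bound ∧ semisimplicity at `T = 0` was
rejected for the birth line: its last piece is Schneider's non-degeneracy at EVERY good ordinary `p`
(catalogued `PAdicHeightBarrier`), which the crux does not need in rank ≤ 3. (3) Structure found by the
refuter (r1): `C ⇒` the shared crux stmt-BirchSwinnertonDyer-0131 (`SelmerRank.SelmerRankLB` = `C` plus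
a big-image hypothesis) and stmt-0131 ∧ stmt-14418 (`ShadowIsolation.SelmerRankSmallImage`) `⇒ C`; that
image split is not used here (the route's thesis excludes image hypotheses). (4) Disproof used: none
exists for this crux (no `Disproof.lean`; the refuter records that no `_false_without_` lemma is
possible since `S → C`); negatives index (2026-08-17): one entry (LeadingTerm `TamePinch`, an `∃p`
surjectivity clause), unrelated to these stubs, which use only `ℕ`-valued `analyticRank` /
`selmerCorank` and the sector hypotheses verbatim from the crux.
-/

-- D-0017: single-problem summit, so `Summit.BirchSwinnertonDyer.BirchSwinnertonDyer.…` repeats a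
-- namespace BY DESIGN.
set_option linter.dupNamespace false

namespace Summit.BirchSwinnertonDyer.BirchSwinnertonDyer.Cruxes.AnalyticRankLeSelmerCorank.Birth

open Literature.NumberTheory.EllipticCurves

/-! ## Stubs (registered; `sorry` only here — names and signatures verbatim as registered on the item) -/

/-- **Stub 1 — the `p`-converse sector `s_p ≤ 1` (in print up to Eisenstein primes).** For `W/ℚ`
globally minimal elliptic and `p ≥ 5` good ordinary: `corank_{ℤ_p} Sel_{p^∞}(E/ℚ) ≤ 1 ⟹
ord_{s=1} L(E,s) ≤ corank_{ℤ_p} Sel_{p^∞}(E/ℚ)`, i.e. `s_p = 0 ⟹ L(E,1) ≠ 0` (rank-zero `p`-converse)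
and `s_p = 1 ⟹ L(E,1) ≠ 0 ∨ L'(E,1) ≠ 0` (non-vanishing half of the rank-one `p`-converse). Why
plausibly true: Burungale–Tian's (1.1) with `r ≤ 1`. Rank zero: proved for `E[p]` irreducible from the
cyclotomic main conjecture and Greenberg's Thm. 4.1 (tree theorem modulo the named facts
`exists_isNewformOf`, `burungale_castella_skinner_charIdeal_eq_padicLFunction`:
`analyticRank_eq_zero_of_selmerCorank_eq_zero_of_mazurMainConjecture`), for CM curves at every `p`
(Burungale–Tian 2026, Thm. 1.1). Rank one: Skinner 2020 Thm. A′, W. Zhang 2014, Burungale–Skinner–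
Tian–Wan 2024 Thm. 1.10 (tree fact `burungaleSkinnerTianWan_analyticRank_eq_one_of_selmerCorank_eq_one`),
Kim 2022 Cor. 1.4, Burungale–Castella–Skinner 2025 (`E[p]` irreducible, `p > 3` good ordinary),
Burungale–Tian 2019 (CM), Castella–Grossi–Lee–Skinner Thm. E (Eisenstein `p`, character condition).
Open residue as typed: Eisenstein `p` outside the CGLS character condition (no image hypothesis may be
added on this route). Size: L (XL to formalise unconditionally). [cite: GreenbergLNM1716, Thm. 4.1]
[cite: BurungaleCastellaSkinner2025, Thm. 1.1.2 (a)] [cite: BurungaleTian2026, Thm. 1.1 and (1.1)]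
[cite: Skinner2020, Thm. A′] [cite: WZhang2014] [cite: BurungaleSkinnerTianWan2024, Thm. 1.10]
[cite: Kim2022, Cor. 1.4] [cite: BurungaleTian2019] [cite: CastellaEtAl2021, Thm. E]
[cite: CastellaGrossiSkinner2025] [cite: SkinnerUrban2014] -/
theorem stub_pConverseSector :
    ∀ (W : WeierstrassCurve ℚ) [W.IsElliptic] [W.IsGloballyMinimal] (p : ℕ) [Fact p.Prime],
      5 ≤ p → W.HasGoodReductionAtPrime p → ¬ (p : ℤ) ∣ W.frobeniusTrace p →
      W.selmerCorank p ≤ 1 → W.analyticRank ≤ W.selmerCorank p := by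
  sorry

/-- **Stub 2 — `p`-parity on the sector (a theorem in print, a named fact in the tree).** For `W/ℚ`
globally minimal elliptic and `p ≥ 5` good ordinary: `corank_{ℤ_p} Sel_{p^∞}(E/ℚ) ≡ ord_{s=1} L(E,s)
(mod 2)` — verbatim the body of the tree fact `selmerCorank_mod_two_eq W p`, restricted to the sector.
In print for all `E/ℚ` and all `p` (Dokchitser–Dokchitser 2010, Thm. 1.4, with `w(E) = (-1)^{r_an}`
from the functional equation); at good ordinary `p` also Nekovář (tree: `selmerCorank_mod_two_eq_of_nekovar`
from the facts `Nekovar2013_theoremA`, `hasEntireLFunction_rat`). Size: S to cite, XL to formalise.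
[cite: DokchitserDokchitserAnnals2010, Thm. 1.4] [cite: Nekovar2013, Thm. A] -/
theorem stub_pParityAdmissible :
    ∀ (W : WeierstrassCurve ℚ) [W.IsElliptic] [W.IsGloballyMinimal] (p : ℕ) [Fact p.Prime],
      5 ≤ p → W.HasGoodReductionAtPrime p → ¬ (p : ℤ) ∣ W.frobeniusTrace p →
      W.selmerCorank p % 2 = W.analyticRank % 2 := by
  sorry

/-- **Stub 3 — the weak bound in corank ≥ 2 (OPEN; the load-bearing stub).** For `W/ℚ` globally
minimal elliptic and `p ≥ 5` good ordinary: `corank_{ℤ_p} Sel_{p^∞}(E/ℚ) ≥ 2 ⟹ ord_{s=1} L(E,s) ≤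
corank_{ℤ_p} Sel_{p^∞}(E/ℚ) + 1`, i.e. `L^{(k)}(E,1) ≠ 0` for some `k ≤ s_p + 1`. Vacuous for `r_an ≤ 3`
(`3 ≤ s_p + 1`); first open cell `r_an = 4, s_p = 2`, in general `r_an ≥ 4` with `s_p = r_an - 2` (the
inequality half of the rank-`s_p` `p`-converse, Burungale–Tian 2026 eq. (1.1) with `r ≥ 2`). Why
plausibly true: it follows from BSD-rank (`r_an = rank ≤ s_p` by the Kummer sequence), so a
counterexample at an admissible `(E,p)` disproves BSD; modulo `p`-parity it is equivalent to the crux on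
this sector. Why it might fail to be provable: no tool produces non-vanishing of a higher derivative
`L^{(k)}(E,1)`, `k ≥ 2`, from Selmer data (no Gross–Zagier formula beyond `k = 1`; generalised Kato
classes run from `L`-vanishing to Selmer classes, Castella–Hsieh 2022). Size: XL (open problem).
[cite: BurungaleTian2026, (1.1)] [cite: CastellaHsieh2022] [cite: GreenbergLNM1716, §1 pp. 54–57] -/
theorem stub_weakBoundCorankGeTwo :
    ∀ (W : WeierstrassCurve ℚ) [W.IsElliptic] [W.IsGloballyMinimal] (p : ℕ) [Fact p.Prime],
      5 ≤ p → W.HasGoodReductionAtPrime p → ¬ (p : ℤ) ∣ W.frobeniusTrace p →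
      2 ≤ W.selmerCorank p → W.analyticRank ≤ W.selmerCorank p + 1 := by
  sorry

/-! ## Composition: the crux from the three stubs (real proof; `sorry` enters only through the stubs) -/

/-- **Composition, hypothesis form (`sorry`-free certificate).** From the three stub SIGNATURES as
hypotheses (verbatim the types of `stub_pConverseSector`, `stub_pParityAdmissible`,
`stub_weakBoundCorankGeTwo`) to the crux's statement, unfolded (so that exactly one theorem of this
file, `AnalyticRankLeSelmerCorank_of` below, concludes the crux by name): split on
`s_p = corank_{ℤ_p} Sel_{p^∞}(E/ℚ)`; `s_p ≤ 1`: the `p`-converse sector gives `r_an ≤ s_p` outright;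
`s_p ≥ 2`: the weak bound gives `r_an ≤ s_p + 1` and `p`-parity `r_an ≡ s_p (mod 2)` excludes
`r_an = s_p + 1` (`omega`). `#print axioms` = `propext`, `Classical.choice`, `Quot.sound`.
[cite: DokchitserDokchitserAnnals2010, Thm. 1.4] [cite: BurungaleTian2026, (1.1)] -/
theorem analyticRank_le_selmerCorank_of_sectors
    (hconv : ∀ (W : WeierstrassCurve ℚ) [W.IsElliptic] [W.IsGloballyMinimal] (p : ℕ) [Fact p.Prime],
      5 ≤ p → W.HasGoodReductionAtPrime p → ¬ (p : ℤ) ∣ W.frobeniusTrace p →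
      W.selmerCorank p ≤ 1 → W.analyticRank ≤ W.selmerCorank p)
    (hpar : ∀ (W : WeierstrassCurve ℚ) [W.IsElliptic] [W.IsGloballyMinimal] (p : ℕ) [Fact p.Prime],
      5 ≤ p → W.HasGoodReductionAtPrime p → ¬ (p : ℤ) ∣ W.frobeniusTrace p →
      W.selmerCorank p % 2 = W.analyticRank % 2)
    (hweak : ∀ (W : WeierstrassCurve ℚ) [W.IsElliptic] [W.IsGloballyMinimal] (p : ℕ) [Fact p.Prime],
      5 ≤ p → W.HasGoodReductionAtPrime p → ¬ (p : ℤ) ∣ W.frobeniusTrace p →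
      2 ≤ W.selmerCorank p → W.analyticRank ≤ W.selmerCorank p + 1) :
    ∀ (W : WeierstrassCurve ℚ) [W.IsElliptic] [W.IsGloballyMinimal] (p : ℕ) [Fact p.Prime],
      5 ≤ p → W.HasGoodReductionAtPrime p → ¬ (p : ℤ) ∣ W.frobeniusTrace p →
      W.analyticRank ≤ W.selmerCorank p := by
  intro W _ _ p _ h5 hgood hord
  rcases Nat.lt_or_ge (W.selmerCorank p) 2 with hlt | hge
  · -- the `p`-converse sector `s_p ≤ 1`
    exact hconv W p h5 hgood hord (by omega)
  · -- `s_p ≥ 2`: weak bound sharpened by `p`-parity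
    have hp : W.selmerCorank p % 2 = W.analyticRank % 2 := hpar W p h5 hgood hord
    have hw : W.analyticRank ≤ W.selmerCorank p + 1 := hweak W p h5 hgood hord hge
    omega

/-- **Composition (line `birth`) — the skeleton theorem.** The crux `AnalyticRankLeSelmerCorank`, BY
NAME, from the three registered stubs and nothing else (the hypothesis form above applied to
`stub_pConverseSector`, `stub_pParityAdmissible`, `stub_weakBoundCorankGeTwo`; the crux decl unfolds
definitionally to the hypothesis form's conclusion). This declaration contains no `sorry` of its own;
its closure reaches `sorryAx` exactly through the three `stub_*`.
[cite: DokchitserDokchitserAnnals2010, Thm. 1.4] [cite: BurungaleTian2026, (1.1)] -/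
theorem AnalyticRankLeSelmerCorank_of :
    Summit.BirchSwinnertonDyer.BirchSwinnertonDyer.Theses.KatoTransfer.AnalyticRankLeSelmerCorank :=
  fun W _ _ p _ h5 hgood hord =>
    analyticRank_le_selmerCorank_of_sectors stub_pConverseSector stub_pParityAdmissible
      stub_weakBoundCorankGeTwo W p h5 hgood hord

/-- **The `r_an ≤ 3` slice of the open stub is vacuous arithmetic** (so its content starts at the first
open cell `r_an = 4, s_p = 2`; refuter note r1): `2 ≤ s_p → r_an ≤ 3 → r_an ≤ s_p + 1`. Recorded as an
`example` so that stub provers aim at `r_an ≥ 4` only. -/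
example (W : WeierstrassCurve ℚ) (p : ℕ) (hs : 2 ≤ W.selmerCorank p) (hr : W.analyticRank ≤ 3) :
    W.analyticRank ≤ W.selmerCorank p + 1 := by
  omega

/-- **Modulo `p`-parity the open stub is the crux on its sector** (refuter note r1, the direction not
already given by `AnalyticRankLeSelmerCorank_of`): the crux's conclusion trivially gives the weak
bound. Recorded as an `example` (informational; the stub is WEAKER than the crux pointwise). -/
example (W : WeierstrassCurve ℚ) (p : ℕ) (h : W.analyticRank ≤ W.selmerCorank p) :
    W.analyticRank ≤ W.selmerCorank p + 1 :=
  Nat.le_succ_of_le h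

end Summit.BirchSwinnertonDyer.BirchSwinnertonDyer.Cruxes.AnalyticRankLeSelmerCorank.Birth
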